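import Summits.AtomisticToContinuum.Crystallization.Theorems.PricedLinkCensusLocalToGlobalFccMirrorGeometry
import Summits.AtomisticToContinuum.Crystallization.Theorems.PricedLinkCensusLocalToGlobalFccMirrorSums

/-!
# The lower bound `S₆(a) ≤ fluxCell` at fcc by replication (stub `stub_fccMirrorExact`, first half)

Route `PricedLinkCensus`, crux `LocalToGlobal` (stmt-AtomisticToContinuum-14232), line
`flux-cell-joint-census`, support for the registered stub `stub_fccMirrorExact : NewtonShell8 → FccMirrorExact`
(`Theorems/PricedLinkCensusLocalToGlobalDefs`).  Registered sub-goal `fccMirror_lowerBound`: under the hypotheses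
of `FccMirrorExact` (an injective configuration coinciding with `yᵢ + fcc(a)` within `3ρ₀a` of the site `i`,
`ρ₀ ≥ 1`, `a > 0`), and given the two analysis statements `NewtonShell8`, `ConfinedThomson` of the line,

  `Σ'_{p ∈ fcc(a) ∖ 0} ‖p‖⁻⁶ ≤ fluxCell (cell ρ₀ y i) (y i) (nnᵢ/2) 0`.

Proof (REPLICATION; no potential theory beyond the two statements).  For `m ∈ ℕ` replicate the cell: the sites
`yᵢ + latVec a j`, `j ∈ [0, m)³ ⊂ ℤ³`, with the lattice translates `latVec a j +ᵥ cell ρ₀ y i` of the cell (open,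
pairwise disjoint, containing the smearing balls of radius `a/2 = nnᵢ/2`:
`PricedLinkCensusLocalToGlobalFccMirrorGeometry`) form an admissible input of `ConfinedThomson` at zero transfer,
whose right-hand side is `m³ · fluxCell` by translation covariance and whose left-hand side is
`Σ_{j ≠ j'} ‖latVec a (j - j')‖⁻⁶` by `NewtonShell8` (distinct lattice points are `≥ a` apart).  The
`(m - 2K)³` sites of the inner box `[K, m - K)³` each see the full box `[-K, K]³` of neighbours, so
`(m - 2K)³ · S_K ≤ m³ · fluxCell` with `S_K = Σ_{j ∈ [-K,K]³} ‖latVec a j‖⁻⁶`; `m → ∞` gives `S_K ≤ fluxCell` for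
every `K`, and the box sums exhaust the lattice sum (`PricedLinkCensusLocalToGlobalFccMirrorSums`).

References: W. Thomson 1848 / Dirichlet's principle (through `ConfinedThomson`); folklore.
-/

noncomputable section

open scoped BigOperators RealInnerProductSpace Pointwise Topology
open MeasureTheory Metric Set Filter Function Literature.Geometry.DiscreteGeometry

namespace Summit.AtomisticToContinuum.Crystallization.Theorems.PricedLinkCensusLocalToGlobal

/-! ### The confined Thomson inequality over an arbitrary finite index type, zero transfer -/

/-- `ConfinedThomson` at `G = 0`, re-indexed by a finite type. [folklore] -/
theorem confinedThomson_fintype (hT : ConfinedThomson) {ι : Type*} [Fintype ι] [DecidableEq ι]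
    (x : ι → E3) (Ω : ι → Set E3) (ε : ι → ℝ) (hΩ : ∀ k, IsOpen (Ω k))
    (hdisj : ∀ k l, k ≠ l → Disjoint (Ω k) (Ω l)) (hball : ∀ k, ball (x k) (ε k) ⊆ Ω k) :
    ∑ k, ∑ l ∈ Finset.univ.erase k, smearedPair (x k) (x l) (ε k) (ε l) ≤
      ∑ k, fluxCell (Ω k) (x k) (ε k) (fun _ => 0) := by
  set e := Fintype.equivFin ι with he
  have h := hT (Fintype.card ι) (x ∘ e.symm) (Ω ∘ e.symm) (ε ∘ e.symm) (fun _ => 0) (fun k => hΩ _)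
    (fun k l hkl => hdisj _ _ fun h => hkl (e.symm.injective h)) (fun k => hball _) MemLp.zero'
    (fun φ _ => by simp)
  have hR : ∑ k, fluxCell ((Ω ∘ e.symm) k) ((x ∘ e.symm) k) ((ε ∘ e.symm) k) (fun _ => 0) =
      ∑ k, fluxCell (Ω k) (x k) (ε k) (fun _ => 0) :=
    e.symm.sum_comp (fun k => fluxCell (Ω k) (x k) (ε k) (fun _ => 0))
  have hL : ∑ k, ∑ l ∈ Finset.univ.erase k,
      smearedPair ((x ∘ e.symm) k) ((x ∘ e.symm) l) ((ε ∘ e.symm) k) ((ε ∘ e.symm) l) =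
      ∑ k, ∑ l ∈ Finset.univ.erase k, smearedPair (x k) (x l) (ε k) (ε l) := by
    have h1 : ∀ k, ∑ l ∈ Finset.univ.erase k,
        smearedPair ((x ∘ e.symm) k) ((x ∘ e.symm) l) ((ε ∘ e.symm) k) ((ε ∘ e.symm) l) =
        ∑ l ∈ Finset.univ.erase (e.symm k), smearedPair (x (e.symm k)) (x l) (ε (e.symm k)) (ε l) := fun k => by
      rw [Finset.sum_erase_eq_sub (Finset.mem_univ _), Finset.sum_erase_eq_sub (Finset.mem_univ _)]
      simp only [Function.comp_apply]
      rw [e.symm.sum_comp (fun l => smearedPair (x (e.symm k)) (x l) (ε (e.symm k)) (ε l))]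
    rw [Finset.sum_congr rfl fun k _ => h1 k]
    exact e.symm.sum_comp (fun k => ∑ l ∈ Finset.univ.erase k, smearedPair (x k) (x l) (ε k) (ε l))
  rw [hL, hR] at h
  exact h

/-! ### Replication: `Σ_{j, j' ∈ [0,m)³} ‖latVec a (j - j')‖⁻⁶ ≤ m³ · fluxCell` -/

section Replication

variable {N : ℕ} {a ρ₀ : ℝ} {y : Fin N → E3} {i : Fin N}

/-- **The replicated inequality.** For every `m`, with the box `[0, m)³ ⊂ ℤ³`:
`Σ_{j ∈ box} Σ_{j' ∈ box} ‖latVec a (j - j')‖⁻⁶ ≤ m³ · fluxCell (cell ρ₀ y i) (y i) (a/2) 0` (the diagonal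
terms are Lean's `0⁻¹ ^ 6 = 0`). [folklore] -/
theorem sum_box_le_mul_fluxCell (hN : NewtonShell8) (hT : ConfinedThomson) (ha : 0 < a) (hρ₀ : 1 ≤ ρ₀)
    (hy : Injective y) (h1 : ∀ j, dist (y j) (y i) ≤ 3 * ρ₀ * a → y j - y i ∈ fccSet a)
    (h2 : ∀ p ∈ fccSet a, ‖p‖ ≤ 3 * ρ₀ * a → ∃ j, y j = y i + p) (m : ℕ) :
    ∑ j ∈ Fintype.piFinset (fun _ : Fin 3 => Finset.Ico (0 : ℤ) m),
      ∑ j' ∈ Fintype.piFinset (fun _ : Fin 3 => Finset.Ico (0 : ℤ) m), ‖latVec a (j - j')‖⁻¹ ^ 6 ≤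
      (m : ℝ) ^ 3 * fluxCell (cell ρ₀ y i) (y i) (a / 2) (fun _ => 0) := by
  classical
  set B : Finset (Fin 3 → ℤ) := Fintype.piFinset (fun _ : Fin 3 => Finset.Ico (0 : ℤ) m) with hB
  set x : B → E3 := fun k => y i + latVec a k.1 with hx
  set Ω : B → Set E3 := fun k => latVec a k.1 +ᵥ cell ρ₀ y i with hΩ
  have hval : ∀ {k l : B}, k ≠ l → (k.1 : Fin 3 → ℤ) ≠ l.1 := fun hkl h => hkl (Subtype.ext h)
  have hT' := confinedThomson_fintype hT x Ω (fun _ => a / 2) (fun k => isOpen_vadd_cell ρ₀ y i _)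
    (fun k l hkl => disjoint_vadd_cell ha hρ₀ hy h1 h2 (latVec_mem_fccSet a _) (latVec_mem_fccSet a _)
      (fun h => hval hkl (latVec_injective ha.ne' h)))
    (fun k => ball_subset_vadd_cell ha hρ₀ hy h1 h2 _)
  -- the right-hand side: `|B| · fluxCell` by translation covariance
  have hcardB : B.card = m ^ 3 := by
    rw [hB, Fintype.card_piFinset, Finset.prod_const, Finset.card_univ, Fintype.card_fin, Int.card_Ico, sub_zero,
      Int.toNat_natCast]
  have hR : ∑ k : B, fluxCell (Ω k) (x k) (a / 2) (fun _ => 0) =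
      (m : ℝ) ^ 3 * fluxCell (cell ρ₀ y i) (y i) (a / 2) (fun _ => 0) := by
    have : ∀ k : B, fluxCell (Ω k) (x k) (a / 2) (fun _ => 0) = fluxCell (cell ρ₀ y i) (y i) (a / 2) (fun _ => 0) :=
      fun k => fluxCell_translate (isOpen_cell ρ₀ y i) (y i) (latVec a k.1) (a / 2)
    rw [Finset.sum_congr rfl fun k _ => this k, Finset.sum_const, Finset.card_univ, Fintype.card_coe, hcardB,
      nsmul_eq_mul]
    push_cast
    ring
  -- the left-hand side: Newton's theorem, and the vanishing diagonal
  have hL : ∑ k : B, ∑ l ∈ Finset.univ.erase k, smearedPair (x k) (x l) (a / 2) (a / 2) =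
      ∑ k : B, ∑ l : B, ‖latVec a (k.1 - l.1)‖⁻¹ ^ 6 := by
    refine Finset.sum_congr rfl fun k _ => ?_
    rw [← Finset.add_sum_erase Finset.univ (fun l : B => ‖latVec a (k.1 - l.1)‖⁻¹ ^ 6) (Finset.mem_univ k),
      sub_self, latVec_zero, norm_zero, inv_zero, zero_pow (by norm_num), zero_add]
    refine Finset.sum_congr rfl fun l hl => ?_
    have hkl : (k.1 : Fin 3 → ℤ) ≠ l.1 := hval (Finset.ne_of_mem_erase hl).symm
    have hdist : dist (x k) (x l) = ‖latVec a (k.1 - l.1)‖ := by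
      rw [hx, dist_eq_norm, add_sub_add_left_eq_sub, latVec_sub]
    have hle : a / 2 + a / 2 ≤ dist (x k) (x l) := by
      rw [add_halves, hdist, latVec_sub]; exact le_norm_latVec_sub ha hkl
    rw [hN (x k) (x l) (a / 2) (a / 2) (half_pos ha) (half_pos ha) hle, hdist]
  rw [hL, hR] at hT'
  -- back to sums over the `Finset` `B`
  have hcoe : ∑ k : B, ∑ l : B, ‖latVec a (k.1 - l.1)‖⁻¹ ^ 6 = ∑ j ∈ B, ∑ j' ∈ B, ‖latVec a (j - j')‖⁻¹ ^ 6 := by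
    rw [← Finset.sum_coe_sort B]
    refine Finset.sum_congr rfl fun k _ => ?_
    exact Finset.sum_coe_sort B (fun j' => ‖latVec a (k.1 - j')‖⁻¹ ^ 6)
  rw [hcoe] at hT'
  exact hT'

/-- The inner box sees full neighbourhoods: for `j ∈ [K, m - K)³`,
`Σ_{j'' ∈ [-K,K]³} ‖latVec a j''‖⁻⁶ ≤ Σ_{j' ∈ [0,m)³} ‖latVec a (j - j')‖⁻⁶`. [folklore] -/
theorem box_sum_le_inner (a : ℝ) {m K : ℕ} {j : Fin 3 → ℤ}
    (hj : j ∈ Fintype.piFinset (fun _ : Fin 3 => Finset.Ico (K : ℤ) ((m : ℤ) - K))) :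
    ∑ j'' ∈ box K, ‖latVec a j''‖⁻¹ ^ 6 ≤
      ∑ j' ∈ Fintype.piFinset (fun _ : Fin 3 => Finset.Ico (0 : ℤ) m), ‖latVec a (j - j')‖⁻¹ ^ 6 := by
  classical
  set B : Finset (Fin 3 → ℤ) := Fintype.piFinset (fun _ : Fin 3 => Finset.Ico (0 : ℤ) m) with hB
  have hjK : ∀ r, (K : ℤ) ≤ j r ∧ j r < (m : ℤ) - K := fun r => by
    have := Fintype.mem_piFinset.1 hj r
    simpa [Finset.mem_Ico] using this
  -- reindex the inner sum by `j'' = j - j'`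
  have hinj : Set.InjOn (fun j' : Fin 3 → ℤ => j - j') B := fun u _ v _ h => sub_right_injective h
  rw [← Finset.sum_image (f := fun w => ‖latVec a w‖⁻¹ ^ 6) hinj]
  refine Finset.sum_le_sum_of_subset_of_nonneg (fun j'' hj'' => ?_) fun _ _ _ => by positivity
  have hK := mem_box.1 hj''
  refine Finset.mem_image.2 ⟨j - j'', Fintype.mem_piFinset.2 fun r => ?_, sub_sub_cancel j j''⟩
  simp only [Pi.sub_apply, Finset.mem_Ico]
  constructor <;> linarith [(hjK r).1, (hjK r).2, (hK r).1, (hK r).2]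

/-- **The box sums are dominated by the flux cell**: `Σ_{j ∈ [-K,K]³} ‖latVec a j‖⁻⁶ ≤ fluxCell` for every
`K` (from `(m - 2K)³ S_K ≤ m³ · fluxCell` as `m → ∞`). [folklore] -/
theorem box_sum_le_fluxCell (hN : NewtonShell8) (hT : ConfinedThomson) (ha : 0 < a) (hρ₀ : 1 ≤ ρ₀)
    (hy : Injective y) (h1 : ∀ j, dist (y j) (y i) ≤ 3 * ρ₀ * a → y j - y i ∈ fccSet a)
    (h2 : ∀ p ∈ fccSet a, ‖p‖ ≤ 3 * ρ₀ * a → ∃ j, y j = y i + p) (K : ℕ) :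
    ∑ j ∈ box K, ‖latVec a j‖⁻¹ ^ 6 ≤ fluxCell (cell ρ₀ y i) (y i) (a / 2) (fun _ => 0) := by
  classical
  set T : ℝ := fluxCell (cell ρ₀ y i) (y i) (a / 2) (fun _ => 0) with hTdef
  set S : ℝ := ∑ j ∈ box K, ‖latVec a j‖⁻¹ ^ 6 with hS
  have hS0 : 0 ≤ S := Finset.sum_nonneg fun _ _ => by positivity
  -- `(m - 2K)³ S ≤ m³ T` for `m ≥ 2K`
  have hm : ∀ m : ℕ, 2 * K ≤ m → ((m : ℝ) - 2 * K) ^ 3 * S ≤ (m : ℝ) ^ 3 * T := fun m hKm => by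
    set B : Finset (Fin 3 → ℤ) := Fintype.piFinset (fun _ : Fin 3 => Finset.Ico (0 : ℤ) m) with hB
    set I : Finset (Fin 3 → ℤ) := Fintype.piFinset (fun _ : Fin 3 => Finset.Ico (K : ℤ) ((m : ℤ) - K)) with hI
    have hIB : I ⊆ B := fun j hj => Fintype.mem_piFinset.2 fun r => by
      have := Fintype.mem_piFinset.1 hj r
      simp only [Finset.mem_Ico] at this ⊢
      constructor <;> linarith [this.1, this.2]
    have hcardI : (I.card : ℝ) = ((m : ℝ) - 2 * K) ^ 3 := by
      have hc : (m : ℤ) - K - K = ((m - 2 * K : ℕ) : ℤ) := by rw [Nat.cast_sub hKm]; push_cast; ring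
      rw [hI, Fintype.card_piFinset, Finset.prod_const, Finset.card_univ, Fintype.card_fin, Int.card_Ico, hc,
        Int.toNat_natCast, Nat.cast_pow, Nat.cast_sub hKm]
      push_cast
      ring_nf
    have hrep := sum_box_le_mul_fluxCell hN hT ha hρ₀ hy h1 h2 m
    calc ((m : ℝ) - 2 * K) ^ 3 * S = ∑ j ∈ I, S := by rw [Finset.sum_const, nsmul_eq_mul, hcardI]
      _ ≤ ∑ j ∈ I, ∑ j' ∈ B, ‖latVec a (j - j')‖⁻¹ ^ 6 := Finset.sum_le_sum fun j hj => box_sum_le_inner a hj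
      _ ≤ ∑ j ∈ B, ∑ j' ∈ B, ‖latVec a (j - j')‖⁻¹ ^ 6 :=
          Finset.sum_le_sum_of_subset_of_nonneg hIB fun _ _ _ => Finset.sum_nonneg fun _ _ => by positivity
      _ ≤ (m : ℝ) ^ 3 * T := hrep
  -- divide by `m³` and let `m → ∞`
  have hev : ∀ᶠ m : ℕ in atTop, S * ((1 : ℝ) - 2 * K / m) ^ 3 ≤ T := by
    refine eventually_atTop.2 ⟨2 * K + 1, fun m hm' => ?_⟩
    have hmpos : (0 : ℝ) < m := by exact_mod_cast (show 0 < m by omega)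
    have h := hm m (by omega)
    have hdiv : S * ((1 : ℝ) - 2 * K / m) ^ 3 = ((m : ℝ) - 2 * K) ^ 3 * S / (m : ℝ) ^ 3 := by
      field_simp
    rw [hdiv, div_le_iff₀ (by positivity)]
    linarith
  have hlim : Tendsto (fun m : ℕ => S * ((1 : ℝ) - 2 * K / m) ^ 3) atTop (𝓝 (S * (1 - 0) ^ 3)) :=
    ((tendsto_const_nhds.sub (tendsto_const_div_atTop_nhds_zero_nat (2 * (K : ℝ)))).pow 3).const_mul S
  rw [sub_zero, one_pow, mul_one] at hlim
  exact le_of_tendsto hlim hev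

end Replication

/-! ### The lower bound -/

/-- **Registered sub-goal `fccMirror_lowerBound`** (line `flux-cell-joint-census`, first half of
`stub_fccMirrorExact`): on an exact fcc patch, given `NewtonShell8` and `ConfinedThomson`, the site's `r⁻⁶`
lattice sum is a LOWER bound for the pure-confinement flux cell,
`Σ'_{p ∈ fcc(a) ∖ 0} ‖p‖⁻⁶ ≤ fluxCell (cell ρ₀ y i) (y i) (nnᵢ/2) 0`. [folklore] -/
theorem fccMirror_lowerBound : ∀ (a ρ₀ : ℝ), 0 < a → 1 ≤ ρ₀ → ∀ (N : ℕ) (y : Fin N → E3) (i : Fin N),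
    Function.Injective y → (∀ j, dist (y j) (y i) ≤ 3 * ρ₀ * a → y j - y i ∈ fccSet a) →
    (∀ p ∈ fccSet a, ‖p‖ ≤ 3 * ρ₀ * a → ∃ j, y j = y i + p) → NewtonShell8 → ConfinedThomson →
    ∑' p : {p : E3 // p ∈ fccSet a ∧ p ≠ 0}, ‖(p : E3)‖⁻¹ ^ 6 ≤
      fluxCell (cell ρ₀ y i) (y i) (nearestDist y i / 2) (fun _ => 0) := by
  intro a ρ₀ ha hρ₀ N y i hy h1 h2 hN hT
  rw [nearestDist_eq_of_fcc ha hρ₀ hy h1 h2]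
  have h0 : 0 ≤ fluxCell (cell ρ₀ y i) (y i) (a / 2) (fun _ => 0) := by
    have h := sum_box_le_mul_fluxCell hN hT ha hρ₀ hy h1 h2 1
    simp only [Nat.cast_one, one_pow, one_mul] at h
    exact (Finset.sum_nonneg fun _ _ => Finset.sum_nonneg fun _ _ => by positivity).trans h
  exact tsum_fccSet_le_of_box_le ha.ne' h0 fun K => box_sum_le_fluxCell hN hT ha hρ₀ hy h1 h2 K

end Summit.AtomisticToContinuum.Crystallization.Theorems.PricedLinkCensusLocalToGlobal

end
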